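import Mathlib
import Literature.Analysis.Calculus.SmoothCutoff

/-!
# Cap profile, step 1: the opening function
(aux `helper_capProfile_opening` for stub `helper_capProfile` of line
`fat-conical-core-avr-logsobolev`, crux `EntropyRung.SubcylindricalExistence`, item
stmt-SmoothPoincare4-10871)

Pure one-variable calculus. For `0 < c ≤ 1`, a rate bound `β > 0` and a start-up bound `δ > 0`
we build a smooth nondecreasing `G : ℝ → ℝ` with `G = 0` on `(-∞, 0]`, `G = 1 - c` on `[L, ∞)`
for some `L ≥ 2`, `0 ≤ G ≤ 1 - c`, `0 ≤ G' ≤ β` everywhere, `G' = 0` on `(-∞, 0]`, `G' ≤ δ` on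
`(-∞, 1]`, and the differential inequality `G' ≤ G` on `[1, ∞)`. This is the "slope defect" that opens the round
log-slope `Q = -2` up to the cone log-slope `Q = -(1 + c)` slowly and under `dQ/dt ≤ -Q(Q + 2)`.

Construction: `G(u) = (1 - c) · η(ε · ST(u) · e^{αu})` with `ST = Real.smoothTransition`, the cap
`η(z) = 1 - (1 - z)(1 - ST(2z - 1))` (`η(z) = z` for `z ≤ 1/2`, `η = 1` on `[1, ∞)`, `η' ≥ 0`), and
`α, ε > 0` small in terms of a bound `B` for `|ST'|`; `L = -log ε / α`.
-/

noncomputable section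

set_option linter.dupNamespace false

open scoped ContDiff Topology
open Set Filter Literature.Analysis.Calculus

namespace Summit.SmoothPoincare4.SmoothPoincare4.Theorems

namespace CapProfileOpening

/-! ### The cap `η(z) = 1 - (1 - z) (1 - ST (2 z - 1))` -/

/-- Derivative of the cap `η`. -/
theorem hasDerivAt_cap (z : ℝ) :
    HasDerivAt (fun z : ℝ => 1 - (1 - z) * (1 - Real.smoothTransition (2 * z - 1)))
      ((1 - Real.smoothTransition (2 * z - 1))
        + (1 - z) * (2 * deriv Real.smoothTransition (2 * z - 1))) z := by
  have h1 : HasDerivAt (fun z : ℝ => 2 * z - 1) 2 z := by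
    simpa using ((hasDerivAt_id z).const_mul (2 : ℝ)).sub_const 1
  have h2 := (differentiable_smoothTransition (2 * z - 1)).hasDerivAt.comp z h1
  have h3 := ((hasDerivAt_const z (1 : ℝ)).fun_sub (hasDerivAt_id' z)).fun_mul
    ((hasDerivAt_const z (1 : ℝ)).fun_sub h2)
  refine ((hasDerivAt_const z (1 : ℝ)).fun_sub h3).congr_deriv ?_
  simp only [Function.comp]
  ring

/-- `η(z) = z` for `z ≤ 1/2`. -/
theorem cap_of_le_half {z : ℝ} (hz : z ≤ 1 / 2) :
    1 - (1 - z) * (1 - Real.smoothTransition (2 * z - 1)) = z := by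
  rw [Real.smoothTransition.zero_of_nonpos (by linarith)]
  ring

/-- `η(z) = 1` for `1 ≤ z`. -/
theorem cap_of_one_le {z : ℝ} (hz : 1 ≤ z) :
    1 - (1 - z) * (1 - Real.smoothTransition (2 * z - 1)) = 1 := by
  rw [Real.smoothTransition.one_of_one_le (by linarith)]
  ring

/-- `0 ≤ η(z) ≤ 1` for `0 ≤ z`. -/
theorem cap_mem {z : ℝ} (hz : 0 ≤ z) :
    0 ≤ 1 - (1 - z) * (1 - Real.smoothTransition (2 * z - 1)) ∧
      1 - (1 - z) * (1 - Real.smoothTransition (2 * z - 1)) ≤ 1 := by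
  rcases le_or_gt z 1 with h1 | h1
  · have h0 := Real.smoothTransition.nonneg (2 * z - 1)
    have h1' := Real.smoothTransition.le_one (2 * z - 1)
    constructor <;> nlinarith
  · rw [cap_of_one_le h1.le]
    norm_num

/-- `1/2 ≤ η(z)` for `1/2 ≤ z`. -/
theorem half_le_cap {z : ℝ} (hz : 1 / 2 ≤ z) :
    1 / 2 ≤ 1 - (1 - z) * (1 - Real.smoothTransition (2 * z - 1)) := by
  rcases le_or_gt z 1 with h1 | h1
  · have h0 := Real.smoothTransition.nonneg (2 * z - 1)
    have h1' := Real.smoothTransition.le_one (2 * z - 1)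
    nlinarith
  · rw [cap_of_one_le h1.le]
    norm_num

/-- `0 ≤ η'`. -/
theorem capD_nonneg (z : ℝ) :
    0 ≤ (1 - Real.smoothTransition (2 * z - 1))
      + (1 - z) * (2 * deriv Real.smoothTransition (2 * z - 1)) := by
  rcases le_or_gt z 1 with h1 | h1
  · exact add_nonneg (sub_nonneg.2 (Real.smoothTransition.le_one _))
      (mul_nonneg (by linarith) (mul_nonneg zero_le_two Real.smoothTransition.monotone.deriv_nonneg))
  · rw [Real.smoothTransition.one_of_one_le (by linarith),
      deriv_smoothTransition_of_one_le (by linarith)]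
    norm_num

/-- `η' ≤ 1 + B` for any bound `B` of `|ST'|`. -/
theorem capD_le {B : ℝ} (hB : ∀ t, |deriv Real.smoothTransition t| ≤ B) (z : ℝ) :
    (1 - Real.smoothTransition (2 * z - 1))
      + (1 - z) * (2 * deriv Real.smoothTransition (2 * z - 1)) ≤ 1 + B := by
  have h0 : 1 - Real.smoothTransition (2 * z - 1) ≤ 1 := by
    linarith [Real.smoothTransition.nonneg (2 * z - 1)]
  have hB0 : 0 ≤ B := (abs_nonneg _).trans (hB 0)
  have key : (1 - z) * (2 * deriv Real.smoothTransition (2 * z - 1)) ≤ B := by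
    rcases lt_or_ge z (1 / 2) with h | h
    · rw [deriv_smoothTransition_of_nonpos (by linarith)]
      simpa using hB0
    have hd := (le_abs_self _).trans (hB (2 * z - 1))
    have hdn := Real.smoothTransition.monotone.deriv_nonneg (x := 2 * z - 1)
    rcases le_or_gt z 1 with h1 | h1
    · nlinarith
    · nlinarith
  linarith

/-- `η'(z) = 1` for `z ≤ 1/2`. -/
theorem capD_of_le_half {z : ℝ} (hz : z ≤ 1 / 2) :
    (1 - Real.smoothTransition (2 * z - 1))
      + (1 - z) * (2 * deriv Real.smoothTransition (2 * z - 1)) = 1 := by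
  rw [Real.smoothTransition.zero_of_nonpos (by linarith),
    deriv_smoothTransition_of_nonpos (by linarith)]
  ring

/-- `η'(z) = 0` for `1 ≤ z`. -/
theorem capD_of_one_le {z : ℝ} (hz : 1 ≤ z) :
    (1 - Real.smoothTransition (2 * z - 1))
      + (1 - z) * (2 * deriv Real.smoothTransition (2 * z - 1)) = 0 := by
  rw [Real.smoothTransition.one_of_one_le (by linarith),
    deriv_smoothTransition_of_one_le (by linarith)]
  ring

/-! ### The ramp `y(u) = ε ST(u) e^{αu}` -/

/-- Derivative of the ramp. -/
theorem hasDerivAt_ramp (ε α u : ℝ) :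
    HasDerivAt (fun u : ℝ => ε * Real.smoothTransition u * Real.exp (α * u))
      (ε * Real.exp (α * u) * (deriv Real.smoothTransition u + α * Real.smoothTransition u)) u := by
  have h1 : HasDerivAt (fun u : ℝ => Real.exp (α * u)) (Real.exp (α * u) * α) u := by
    simpa using ((hasDerivAt_id u).const_mul α).exp
  refine (((differentiable_smoothTransition u).hasDerivAt.const_mul ε).fun_mul h1).congr_deriv ?_
  ring

end CapProfileOpening

open CapProfileOpening in
/-- **The opening function.** For `0 < c ≤ 1`, `β > 0`, `δ > 0` there are a smooth `G : ℝ → ℝ`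
and `L ≥ 2` with: `G = 0` on `(-∞, 0]`, `G = 1 - c` on `[L, ∞)`, `0 ≤ G ≤ 1 - c`,
`0 ≤ G' ≤ β` everywhere, `G' = 0` on `(-∞, 0]`, `G' ≤ δ` on `(-∞, 1]`, and `G' ≤ G` on
`[1, ∞)`. -/
theorem helper_capProfile_opening :
    ∀ c : ℝ, 0 < c → c ≤ 1 → ∀ β : ℝ, 0 < β → ∀ δ : ℝ, 0 < δ →
      ∃ G : ℝ → ℝ, ∃ L : ℝ, ContDiff ℝ ∞ G ∧ 2 ≤ L ∧
        (∀ u, u ≤ 0 → G u = 0) ∧ (∀ u, L ≤ u → G u = 1 - c) ∧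
        (∀ u, 0 ≤ G u ∧ G u ≤ 1 - c) ∧
        (∀ u, 0 ≤ deriv G u ∧ deriv G u ≤ β) ∧
        (∀ u, u ≤ 0 → deriv G u = 0) ∧
        (∀ u, u ≤ 1 → deriv G u ≤ δ) ∧
        (∀ u, 1 ≤ u → deriv G u ≤ G u) := by
  intro c hc hc1 β hβ δ hδ
  obtain ⟨B, hB0, hB⟩ := exists_bound_deriv_smoothTransition
  have hB1 : 0 < 1 + B := by linarith
  -- the two small parameters
  obtain ⟨α, hα0, hα1, hαB, hαβ⟩ : ∃ α : ℝ, 0 < α ∧ α ≤ 1 ∧ α * (1 + B) ≤ 1 / 2 ∧ α * (1 + B) ≤ β := by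
    refine ⟨min (1 / 2) β / (1 + B), div_pos (lt_min (by norm_num) hβ) hB1, ?_, ?_, ?_⟩
    · rw [div_le_one hB1]
      exact (min_le_left _ _).trans (by linarith)
    · rw [div_mul_cancel₀ _ hB1.ne']
      exact min_le_left _ _
    · rw [div_mul_cancel₀ _ hB1.ne']
      exact min_le_right _ _
  obtain ⟨ε, hε0, hε2, hεδ, hεβ⟩ : ∃ ε : ℝ, 0 < ε ∧ ε ≤ Real.exp (-2) ∧
      ε * (Real.exp 1 * (1 + B) ^ 2) ≤ δ ∧ ε * (Real.exp 1 * (1 + B) ^ 2) ≤ β := by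
    have hpos : 0 < Real.exp 1 * (1 + B) ^ 2 := mul_pos (Real.exp_pos 1) (pow_pos hB1 2)
    refine ⟨min (Real.exp (-2)) (min δ β / (Real.exp 1 * (1 + B) ^ 2)),
      lt_min (Real.exp_pos _) (div_pos (lt_min hδ hβ) hpos), min_le_left _ _, ?_, ?_⟩
    · calc _ ≤ min δ β / (Real.exp 1 * (1 + B) ^ 2) * (Real.exp 1 * (1 + B) ^ 2) :=
            mul_le_mul_of_nonneg_right (min_le_right _ _) hpos.le
        _ = min δ β := div_mul_cancel₀ _ hpos.ne'
        _ ≤ δ := min_le_left _ _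
    · calc _ ≤ min δ β / (Real.exp 1 * (1 + B) ^ 2) * (Real.exp 1 * (1 + B) ^ 2) :=
            mul_le_mul_of_nonneg_right (min_le_right _ _) hpos.le
        _ = min δ β := div_mul_cancel₀ _ hpos.ne'
        _ ≤ β := min_le_right _ _
  -- the length of the opening
  set L : ℝ := -Real.log ε / α with hL
  have hlogε : 2 ≤ -Real.log ε := by
    have := (Real.log_le_iff_le_exp hε0).2 hε2
    linarith
  have hL2 : 2 ≤ L := by
    rw [hL, le_div_iff₀ hα0]
    nlinarith
  have hαL : α * L = -Real.log ε := by
    rw [hL]; field_simp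
  -- the ramp and the opening function
  set y : ℝ → ℝ := fun u => ε * Real.smoothTransition u * Real.exp (α * u) with hy
  set G : ℝ → ℝ := fun u =>
    (1 - c) * (1 - (1 - y u) * (1 - Real.smoothTransition (2 * y u - 1))) with hG
  have hy0 : ∀ u, 0 ≤ y u := fun u =>
    mul_nonneg (mul_nonneg hε0.le (Real.smoothTransition.nonneg u)) (Real.exp_pos _).le
  have hy_smooth : ContDiff ℝ ∞ y :=
    (contDiff_const.mul Real.smoothTransition.contDiff).mul (contDiff_const.mul contDiff_id).exp
  have hG_smooth : ContDiff ℝ ∞ G :=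
    contDiff_const.mul (contDiff_const.sub ((contDiff_const.sub hy_smooth).mul
      (contDiff_const.sub (Real.smoothTransition.contDiff.comp
        ((contDiff_const.mul hy_smooth).sub contDiff_const)))))
  -- the derivative of `G`
  have hGd : ∀ u, HasDerivAt G ((1 - c) * (((1 - Real.smoothTransition (2 * y u - 1))
      + (1 - y u) * (2 * deriv Real.smoothTransition (2 * y u - 1)))
      * (ε * Real.exp (α * u) * (deriv Real.smoothTransition u + α * Real.smoothTransition u)))) u :=
    fun u => ((hasDerivAt_cap (y u)).comp u (hasDerivAt_ramp ε α u)).const_mul (1 - c)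
  -- the ramp derivative: nonnegative, small on `u ≤ 1`, `= α y` on `1 ≤ u`
  have hyD0 : ∀ u, 0 ≤ ε * Real.exp (α * u) *
      (deriv Real.smoothTransition u + α * Real.smoothTransition u) := fun u =>
    mul_nonneg (mul_nonneg hε0.le (Real.exp_pos _).le)
      (add_nonneg Real.smoothTransition.monotone.deriv_nonneg
        (mul_nonneg hα0.le (Real.smoothTransition.nonneg u)))
  have hyD1 : ∀ u, u ≤ 1 → ε * Real.exp (α * u) *
      (deriv Real.smoothTransition u + α * Real.smoothTransition u) ≤ ε * (Real.exp 1 * (1 + B)) := by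
    intro u hu
    have h1 : Real.exp (α * u) ≤ Real.exp 1 := Real.exp_le_exp.2 (by nlinarith)
    have h2 : deriv Real.smoothTransition u + α * Real.smoothTransition u ≤ 1 + B := by
      have := (le_abs_self _).trans (hB u)
      have := Real.smoothTransition.le_one u
      have := Real.smoothTransition.nonneg u
      nlinarith
    rw [mul_assoc]
    refine mul_le_mul_of_nonneg_left ?_ hε0.le
    exact mul_le_mul h1 h2 (add_nonneg Real.smoothTransition.monotone.deriv_nonneg
      (mul_nonneg hα0.le (Real.smoothTransition.nonneg u))) (Real.exp_pos 1).le
  have hyD2 : ∀ u, 1 ≤ u → ε * Real.exp (α * u) *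
      (deriv Real.smoothTransition u + α * Real.smoothTransition u) = α * y u := by
    intro u hu
    simp only [hy, Real.smoothTransition.one_of_one_le hu, deriv_smoothTransition_of_one_le hu]
    ring
  -- bounds for the cap derivative
  have hcapD0 := capD_nonneg
  have hcapD1 := capD_le hB
  have hG0 : ∀ u, u ≤ 0 → G u = 0 := by
    intro u hu
    have hyu : y u = 0 := by simp [hy, Real.smoothTransition.zero_of_nonpos hu]
    simp only [hG, hyu]
    rw [cap_of_le_half (by norm_num)]
    ring
  have hGmem : ∀ u, 0 ≤ G u ∧ G u ≤ 1 - c := by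
    intro u
    have h := cap_mem (hy0 u)
    simp only [hG]
    exact ⟨mul_nonneg (by linarith) h.1, mul_le_of_le_one_right (by linarith) h.2⟩
  refine ⟨G, L, hG_smooth, hL2, hG0, ?_, hGmem, ?_, ?_, ?_, ?_⟩
  · -- `G = 1 - c` on `L ≤ u`
    intro u hu
    have hu1 : 1 ≤ u := by linarith
    have hyu : 1 ≤ y u := by
      have h1 : Real.exp (α * L) ≤ Real.exp (α * u) := Real.exp_le_exp.2 (by nlinarith)
      rw [hαL, Real.exp_neg, Real.exp_log hε0] at h1
      have h2 : y u = ε * Real.exp (α * u) := by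
        simp [hy, Real.smoothTransition.one_of_one_le hu1]
      rw [h2]
      calc (1 : ℝ) = ε * ε⁻¹ := (mul_inv_cancel₀ hε0.ne').symm
        _ ≤ ε * Real.exp (α * u) := mul_le_mul_of_nonneg_left h1 hε0.le
    simp only [hG]
    rw [cap_of_one_le hyu]
    ring
  · -- `0 ≤ G' ≤ β`
    intro u
    rw [(hGd u).deriv]
    refine ⟨mul_nonneg (by linarith) (mul_nonneg (hcapD0 _) (hyD0 u)), ?_⟩
    rcases le_or_gt u 1 with hu | hu
    · calc _ ≤ (1 : ℝ) * ((1 + B) * (ε * (Real.exp 1 * (1 + B)))) :=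
            mul_le_mul (by linarith) (mul_le_mul (hcapD1 _) (hyD1 u hu) (hyD0 u)
              hB1.le) (mul_nonneg (hcapD0 _) (hyD0 u)) zero_le_one
        _ = ε * (Real.exp 1 * (1 + B) ^ 2) := by ring
        _ ≤ β := hεβ
    · rw [hyD2 u hu.le]
      rcases le_or_gt (y u) 1 with hy1 | hy1
      · calc _ ≤ (1 : ℝ) * ((1 + B) * (α * 1)) :=
              mul_le_mul (by linarith) (mul_le_mul (hcapD1 _)
                (mul_le_mul_of_nonneg_left hy1 hα0.le) (mul_nonneg hα0.le (hy0 u)) hB1.le)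
                (mul_nonneg (hcapD0 _) (mul_nonneg hα0.le (hy0 u))) zero_le_one
          _ = α * (1 + B) := by ring
          _ ≤ β := hαβ
      · rw [capD_of_one_le hy1.le]
        simpa using hβ.le
  · -- `G' = 0` on `u ≤ 0` (a global minimum of `G`)
    intro u hu
    refine IsLocalMin.deriv_eq_zero (Filter.Eventually.of_forall fun v => ?_)
    rw [hG0 u hu]
    exact (hGmem v).1
  · -- `G' ≤ δ` on `u ≤ 1`
    intro u hu
    rw [(hGd u).deriv]
    calc _ ≤ (1 : ℝ) * ((1 + B) * (ε * (Real.exp 1 * (1 + B)))) :=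
          mul_le_mul (by linarith) (mul_le_mul (hcapD1 _) (hyD1 u hu) (hyD0 u)
            hB1.le) (mul_nonneg (hcapD0 _) (hyD0 u)) zero_le_one
      _ = ε * (Real.exp 1 * (1 + B) ^ 2) := by ring
      _ ≤ δ := hεδ
  · -- `G' ≤ G` on `1 ≤ u`
    intro u hu
    rw [(hGd u).deriv, hyD2 u hu]
    simp only [hG]
    refine mul_le_mul_of_nonneg_left ?_ (by linarith)
    rcases le_or_gt (y u) (1 / 2) with h1 | h1
    · rw [capD_of_le_half h1, cap_of_le_half h1]
      nlinarith [hy0 u]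
    rcases le_or_gt (y u) 1 with h2 | h2
    · have hc' := half_le_cap h1.le
      calc _ ≤ (1 + B) * (α * 1) :=
            mul_le_mul (hcapD1 _) (mul_le_mul_of_nonneg_left h2 hα0.le)
              (mul_nonneg hα0.le (hy0 u)) hB1.le
        _ ≤ 1 / 2 := by linarith
        _ ≤ _ := hc'
    · rw [capD_of_one_le h2.le, cap_of_one_le h2.le]
      norm_num

end Summit.SmoothPoincare4.SmoothPoincare4.Theorems

end
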